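import Literature.AlgebraicGeometry.Motives.StandardConjecturesLefschetzProofs
import Literature.AlgebraicGeometry.Motives.LefschetzStarProofs
import HarnessLib

/-!
# The standard conjecture of Lefschetz type: `B(X) ⇔ ⋆` algebraic (proofs)

`Literature.AlgebraicGeometry.Motives.StandardConjectures` records as a named fact (hodge.S29)
`standardConjectureB_iff_isAlgebraicGradedOp_lefschetzStar`: under hard Lefschetz, for `X` smooth
projective of dimension `n` with hyperplane class `η`, the `θ`-form of Grothendieck's standard
conjecture `B(X, η)` (the inverses of the hard-Lefschetz isomorphisms `Lⁿ⁻ⁱ : Hⁱ ⥲ H²ⁿ⁻ⁱ` are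
induced by algebraic correspondences with `ℚ`-coefficients) is equivalent to the algebraicity of
Kleiman's Hodge-star-like involution `⋆` of `(X, η)` (S. Kleiman, *The standard conjectures*,
Motives (Seattle 1991), PSPM 55.1 (1994), Thm 4-1; S. Kleiman, *Algebraic cycles and the Weil
conjectures* (1968), Prop. 2.3 with 1.4.2, `Λ = ⋆ L ⋆`). This file **proves** it
(`standardConjectureB_iff_isAlgebraicGradedOp_lefschetzStar_holds`), formally in the axioms of
`Literature.AlgebraicGeometry.Motives.WeilCohomology` plus the hard Lefschetz hypothesis, on top of
the sibling discharges `standardConjectureC_of_standardConjectureB_holds`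
(`StandardConjecturesKunnethProofs`) and `standardConjectureB_iff_standardConjectureBΛ_holds`
(`StandardConjecturesLefschetzProofs`).

## Proof architecture

The point is that `W.IsAlgebraicGradedOp` asks for rational algebraic classes `u_c` inducing *all*
components of a graded operator at once, so that a one-component operator (`W.IsAlgebraicOperator`,
the form in which `B(X)` asks for the `θ`'s) is algebraic only through the Künneth projectors.

* § `B ⇒ ⋆` (Kleiman 1968 Prop. 2.3, `B ⇒ ⋆` algebraic): `B(X)` gives `C(X)`
  (`standardConjectureC_of_standardConjectureB_holds`), hence every `Lʳ : Hⁱ → Hⁱ⁺²ʳ` and every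
  `(Lʳ)⁻¹ = θ` is an algebraic one-component operator (`CorrespondencesAlgebraicOperators`);
  following the two-step recursion defining `signOp` and the formula for `starOp`
  (`LefschetzStarProofs`), every component of `⋆ = starOp` is algebraic, and `⋆` is the finite sum
  of its components; uniqueness of `⋆` (`isLefschetzStar_unique`) transfers this to any `⋆`.
* § `⋆ ⇒ B` (the printed route, Kleiman 1968 1.4.2 with Prop. 2.3): the composite graded operator
  `⋆ ∘ L ∘ ⋆` satisfies Kleiman's characterisation of `Λ` (`isLambdaOp_star_lefschetz_star`, checked
  on the Lefschetz summands with the sign rule `⋆ Lʲ x = (-1)^{i(i+1)/2} Lⁿ⁻ⁱ⁻ʲ x`), so by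
  uniqueness of `Λ` (`isLambdaOp_unique`) an algebraic `⋆` makes `Λ` algebraic
  (`isAlgebraicGradedOp_comp_holds`, `isAlgebraicGradedOp_lefschetzGrPow`), i.e. `B(X)` in `Λ`-form,
  which is `B(X)` in `θ`-form by `standardConjectureB_of_standardConjectureBΛ`.

Depends only on (beyond the hypothesis `W.HasHardLefschetz`): the discharged facts
`existsUnique_isLefschetzStar` (construction `starOp`), `existsUnique_isLambdaOp`
(`isLambdaOp_unique`), `isAlgebraicGradedOp_comp`, `standardConjectureC_of_standardConjectureB`,
`standardConjectureB_iff_standardConjectureBΛ` and their listed dependencies (`exists_isInducedBy_id`,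
`map_cup`, `cup_assoc`, `pullback_ratAlgebraicClasses_le`, `cup_mem_ratAlgebraicClasses`,
`cycleClass_of_coheight_eq_zero`, `IsSmoothProjective.tensor_holds`, `isPerfPair_cupPairing`,
`finite_obj`, `subsingleton_obj`), divisibility of `ratAlgebraicClasses` (the signs `±1`), and the
cup-product axioms behind `lefschetzPow_lefschetzPow`. No new axioms, no `sorry`, no new definitions
or named facts; nothing of `StandardConjectures.lean` is restated or modified.

## References

* S. Kleiman, *The standard conjectures*, in: Motives (Seattle, WA, 1991), Proc. Sympos. Pure
  Math. 55, Part 1, Amer. Math. Soc. (1994), 3–20, Thm 4-1. [Kleiman1994StandardConjectures]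
* S. Kleiman, *Algebraic cycles and the Weil conjectures*, in: Dix exposés sur la cohomologie des
  schémas, North-Holland (1968), §1.4 (1.4.2, 1.4.4), Prop. 2.3. [Kleiman1968AlgebraicCycles]
* A. Grothendieck, *Standard conjectures on algebraic cycles*, Bombay 1968. [Grothendieck1968]
-/

universe u v

open CategoryTheory AlgebraicGeometry MonoidalCategory CartesianMonoidalCategory Opposite
open scoped TensorProduct

noncomputable section

namespace Literature.AlgebraicGeometry.Motives

/-! ## Components of composites with `Lˢ` and with `⋆` -/

namespace PreWeilCohomology

variable {k : Type u} [Field k] {K : Type v} [Field K] (W : PreWeilCohomology k K)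
variable {X Y : SchemeOver k}

/-- Pre-composition with the graded `Lˢ`: `(P ∘ Lˢ)ᵢⱼ = P_{i+2s, j} ∘ Lˢ`. [folklore] -/
theorem comp_lefschetzGrPow_apply (P : W.GradedOp X Y) (η : W.obj X 2) (s i j : ℕ) :
    P.comp (W.lefschetzGrPow X η s) i j =
      P (i + 2 * s) j ∘ₗ W.lefschetzPow X η s i (i + 2 * s) rfl := by
  rw [GradedOp.comp_apply_of_source_vanish _ _ (i + 2 * s) fun m hm ↦
    W.lefschetzGrPow_of_ne η s fun h ↦ hm h.symm, W.lefschetzGrPow_apply η s rfl]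

/-- Pre-composition with a Lefschetz star operator `⋆` (its components off total degree `2n`
vanish): `(P ∘ ⋆)ᵢⱼ = P_{d, j} ∘ ⋆ᵢ_d` for `i + d = 2n`. [folklore] -/
theorem comp_apply_of_isLefschetzStar {n : ℕ} {η : W.obj X 2} {S : W.GradedOp X X}
    (hS : W.IsLefschetzStar n η S) (P : W.GradedOp X Y) {i d : ℕ} (hd : i + d = 2 * n) (j : ℕ) :
    P.comp S i j = P d j ∘ₗ S i d :=
  GradedOp.comp_apply_of_source_vanish _ _ d fun m hm ↦ hS.1 i m (by omega)

/-- Above degree `2n` the composite `P ∘ ⋆` has no nonzero term. [folklore] -/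
theorem comp_apply_of_isLefschetzStar_of_lt {n : ℕ} {η : W.obj X 2} {S : W.GradedOp X X}
    (hS : W.IsLefschetzStar n η S) (P : W.GradedOp X Y) {i : ℕ} (hi : 2 * n < i) (j : ℕ) :
    P.comp S i j = 0 :=
  GradedOp.comp_apply_eq_zero _ _ fun m ↦ by rw [hS.1 i m (by omega), LinearMap.comp_zero]

end PreWeilCohomology

namespace WeilCohomology

variable {k : Type u} [Field k] {K : Type v} [Field K] [CharZero K] (W : WeilCohomology k K)
variable {n : ℕ} {X : SchemeOver k} {η : W.obj X 2}

/-- A hyperplane class is a rational algebraic class (`η = η¹`, and positive powers of hyperplane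
classes are rational algebraic, `pow_mem_ratAlgebraicClasses_of_isHyperplaneClass`). [folklore] -/
private theorem mem_ratAlgebraicClasses_of_isHyperplaneClass_aux (hX : IsSmoothProjective n X)
    (hη : W.IsHyperplaneClass X η) : η ∈ W.ratAlgebraicClasses X 1 := by
  have h1 : W.pow X η 1 = η := W.one_cup hX rfl η
  simpa only [h1] using W.pow_mem_ratAlgebraicClasses_of_isHyperplaneClass hX hη le_rfl

/-- `ε • ε • y = y` for Kleiman's signs `ε = ±1`. [folklore] -/
private theorem negOnePow_smul_negOnePow_smul {M : Type*} [AddCommGroup M] (c : ℤ) (y : M) :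
    ((c.negOnePow : ℤˣ) : ℤ) • ((c.negOnePow : ℤˣ) : ℤ) • y = y := by
  rw [smul_smul, ← Units.val_mul, Int.units_mul_self, Units.val_one, one_smul]

variable {W}

/-- Integer multiples of algebraic operators are algebraic. [folklore] -/
theorem _root_.Literature.AlgebraicGeometry.Motives.PreWeilCohomology.IsAlgebraicOperator.intCast_smul
    {nX nY i j : ℕ} {Y : SchemeOver k} {T : W.obj X i →ₗ[K] W.obj Y j}
    (hT : W.IsAlgebraicOperator nX nY T) (z : ℤ) : W.IsAlgebraicOperator nX nY ((z : K) • T) := by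
  simpa only [Rat.cast_intCast] using hT.ratCast_smul (z : ℚ)

/-! ## `B(X) ⇒ ⋆` algebraic -/

section BtoStar

/-- Under `B(X)` (in `θ`-form) every Künneth projector `πᵃ = id : Hᵃ(X) → Hᵃ(X)` is an algebraic
one-component operator: this is `B(X) ⇒ C(X)` (Kleiman 1968 §2; the discharged fact
`standardConjectureC_of_standardConjectureB`, `StandardConjecturesKunnethProofs`) through
`standardConjectureC_iff`. [cite: Kleiman1968AlgebraicCycles, §2 (B(X) ⇒ C(X))] -/
theorem isAlgebraicOperator_id_of_standardConjectureB (hX : IsSmoothProjective n X)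
    (hη : W.IsHyperplaneClass X η) (hB : W.StandardConjectureB n X η) (a : ℕ) :
    W.IsAlgebraicOperator n n (LinearMap.id : W.obj X a →ₗ[K] W.obj X a) :=
  WeilCohomology.standardConjectureC_iff.mp
    (standardConjectureC_of_standardConjectureB_holds hX hη hB) a

/-- Under `B(X)` every Lefschetz operator `Lʳ : Hⁱ(X) → Hⁱ⁺²ʳ(X)`, as a one-component operator,
is algebraic (`Lʳ = id ∘ Lʳ` with `id = π` algebraic). [folklore] -/
theorem isAlgebraicOperator_lefschetzPow_of_standardConjectureB (hX : IsSmoothProjective n X)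
    (hη : W.IsHyperplaneClass X η) (hB : W.StandardConjectureB n X η) {i r j : ℕ}
    (h : i + 2 * r = j) : W.IsAlgebraicOperator n n (W.lefschetzPow X η r i j h) := by
  have halg :=
    (W.isAlgebraicOperator_id_of_standardConjectureB hX hη hB j).comp_lefschetzPow hX hX hη h
  rwa [LinearMap.id_comp] at halg

/-- Under `B(X)` the inverse `(Lʳ)⁻¹ : H²ⁿ⁻ⁱ(X) → Hⁱ(X)` of a hard-Lefschetz isomorphism is
algebraic: it *is* the algebraic `θ` provided by `B(X)` (two-sided inverses are unique). [folklore] -/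
theorem isAlgebraicOperator_hardLefschetzEquiv_symm (hB : W.StandardConjectureB n X η)
    (hL : W.HasHardLefschetz) (hX : IsSmoothProjective n X) (hη : W.IsHyperplaneClass X η)
    {i r j : ℕ} (hr : i + r = n) (h : i + 2 * r = j) :
    W.IsAlgebraicOperator n n (W.hardLefschetzEquiv hL hX hη i r j hr h).symm.toLinearMap := by
  obtain ⟨θ, hθ, halg⟩ := hB i r j hr h
  have hθ' : (W.hardLefschetzEquiv hL hX hη i r j hr h).symm.toLinearMap = θ := by
    refine LinearMap.ext fun y ↦ (W.hardLefschetzEquiv hL hX hη i r j hr h).injective ?_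
    rw [LinearEquiv.coe_toLinearMap, LinearEquiv.apply_symm_apply, hardLefschetzEquiv_apply,
      ← LinearMap.comp_apply, hθ.2.2, LinearMap.id_apply]
  rw [hθ']
  exact halg

/-- Under `B(X)` the operator `lowerOp = (Lʳ⁺²)⁻¹ ∘ Lʳ⁺¹ : Hᵐ⁺²(X) → Hᵐ(X)` is algebraic. [folklore] -/
theorem isAlgebraicOperator_lowerOp (hB : W.StandardConjectureB n X η) (hL : W.HasHardLefschetz)
    (hX : IsSmoothProjective n X) (hη : W.IsHyperplaneClass X η) {m r : ℕ} (hr : m + 2 + r = n) :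
    W.IsAlgebraicOperator n n (W.lowerOp hL hX hη m r hr) :=
  (W.isAlgebraicOperator_hardLefschetzEquiv_symm hB hL hX hη _ rfl).comp_lefschetzPow hX hX hη _

/-- Under `B(X)` the sign operator of `⋆` (Kleiman's sign `(-1)^{i(i+1)/2}` on `Lʲ Pⁱ(X)`) is
algebraic in every degree `a ≤ n`: two-step induction along its recursive definition through
`Hᵐ⁺² = Pᵐ⁺² ⊕ L Hᵐ` (Kleiman 1968 Prop. 2.3: the primitive projectors are universal polynomials
in `L` and the `θ`'s). [cite: Kleiman1968AlgebraicCycles, Prop. 2.3] -/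
theorem isAlgebraicOperator_signOp (hB : W.StandardConjectureB n X η) (hL : W.HasHardLefschetz)
    (hX : IsSmoothProjective n X) (hη : W.IsHyperplaneClass X η) :
    ∀ (a r : ℕ) (hr : a + r = n), W.IsAlgebraicOperator n n (W.signOp hL hX hη a r hr)
  | 0, _, _ => by
    rw [signOp]
    exact (W.isAlgebraicOperator_id_of_standardConjectureB hX hη hB 0).intCast_smul _
  | 1, _, _ => by
    rw [signOp]
    exact (W.isAlgebraicOperator_id_of_standardConjectureB hX hη hB 1).intCast_smul _
  | m + 2, r, hr => by
    rw [signOp]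
    have hlow := W.isAlgebraicOperator_lowerOp hB hL hX hη hr
    have hL1 : W.IsAlgebraicOperator n n (W.lefschetzPow X η 1 m (m + 2) (by omega)) :=
      W.isAlgebraicOperator_lefschetzPow_of_standardConjectureB hX hη hB _
    exact (((W.isAlgebraicOperator_id_of_standardConjectureB hX hη hB (m + 2)).sub
      (hL1.comp hX hX hX hlow)).intCast_smul _).add (hL1.comp hX hX hX
        ((isAlgebraicOperator_signOp hB hL hX hη m (r + 2) (by omega)).comp hX hX hX hlow))

/-- Under `B(X)` every component of Kleiman's `⋆ = starOp` is an algebraic (one-component)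
operator: `⋆|_{Hᵃ} = Lⁿ⁻ᵃ ∘ signOp` (`a ≤ n`), `⋆|_{Hᵃ} = signOp ∘ (Lᵃ⁻ⁿ)⁻¹` (`n < a ≤ 2n`)
(Kleiman 1968 Prop. 2.3 with 1.4.2; Kleiman 1994 Thm 4-1, `B ⇒ ⋆` algebraic). [cite: Kleiman1968AlgebraicCycles, Prop. 2.3] -/
theorem isAlgebraicOperator_starOp (hB : W.StandardConjectureB n X η) (hL : W.HasHardLefschetz)
    (hX : IsSmoothProjective n X) (hη : W.IsHyperplaneClass X η) (a b : ℕ) :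
    W.IsAlgebraicOperator n n (W.starOp hL hX hη a b) := by
  unfold starOp
  by_cases hab : a + b = 2 * n
  · rw [dif_pos hab]
    by_cases ha : a ≤ n
    · rw [dif_pos ha]
      exact (W.isAlgebraicOperator_lefschetzPow_of_standardConjectureB hX hη hB _).comp hX hX hX
        (W.isAlgebraicOperator_signOp hB hL hX hη a (n - a) _)
    · rw [dif_neg ha]
      exact (W.isAlgebraicOperator_signOp hB hL hX hη b (n - b) _).comp hX hX hX
        (W.isAlgebraicOperator_hardLefschetzEquiv_symm hB hL hX hη _ _)
  · rw [dif_neg hab]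
    exact W.isAlgebraicOperator_zero

/-- A Lefschetz star operator is the (finite) sum of its one-component pieces
`⋆ₐ : Hᵃ(X) → H²ⁿ⁻ᵃ(X)`, `a ≤ 2n`. [folklore] -/
theorem eq_sum_ofLinearMap_of_isLefschetzStar {S : W.GradedOp X X}
    (hS : W.IsLefschetzStar n η S) :
    S = ∑ a ∈ Finset.range (2 * n + 1),
      PreWeilCohomology.GradedOp.ofLinearMap (S a (2 * n - a)) := by
  funext a b
  rw [Finset.sum_apply, Finset.sum_apply]
  by_cases hab : a + b = 2 * n
  · rw [Finset.sum_eq_single a]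
    · obtain rfl : b = 2 * n - a := by omega
      rw [PreWeilCohomology.GradedOp.ofLinearMap_apply_same]
    · intro a' _ ha'
      exact PreWeilCohomology.GradedOp.ofLinearMap_apply_of_ne _ fun h ↦ ha' h.1
    · intro ha
      exact absurd (Finset.mem_range.mpr (by omega)) ha
  · rw [hS.1 a b hab]
    refine (Finset.sum_eq_zero fun a' ha' ↦ ?_).symm
    rw [Finset.mem_range] at ha'
    exact PreWeilCohomology.GradedOp.ofLinearMap_apply_of_ne _ fun ⟨h1, h2⟩ ↦ hab (by omega)

/-- **`B(X) ⇒ ⋆` algebraic** (Kleiman 1968 Prop. 2.3 with 1.4.2; Kleiman 1994 Thm 4-1): under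
`B(X, η)` in `θ`-form every Lefschetz star operator `⋆` of `(X, η)` is induced by algebraic
correspondences with `ℚ`-coefficients, as a graded operator. The `θ`'s make the Künneth
projectors algebraic, hence every `Lʳ : Hⁱ → Hⁱ⁺²ʳ` and `(Lʳ)⁻¹` as one-component operators, hence
the components of `⋆ = starOp` (`isAlgebraicOperator_starOp`), and `⋆` is their sum. [cite: Kleiman1994StandardConjectures, Thm 4-1] -/
theorem isAlgebraicGradedOp_of_isLefschetzStar_of_standardConjectureB (hL : W.HasHardLefschetz)
    (hX : IsSmoothProjective n X) (hη : W.IsHyperplaneClass X η) (hB : W.StandardConjectureB n X η)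
    {S : W.GradedOp X X} (hS : W.IsLefschetzStar n η S) : W.IsAlgebraicGradedOp n n S := by
  obtain rfl := W.isLefschetzStar_unique hL hX hη hS (W.isLefschetzStar_starOp hL hX hη)
  rw [W.eq_sum_ofLinearMap_of_isLefschetzStar hS]
  exact W.isAlgebraicGradedOp_sum _ _ fun a _ ↦
    W.isAlgebraicOperator_starOp hB hL hX hη a (2 * n - a)

end BtoStar

/-! ## `⋆` algebraic ⇒ `B(X)`, through `Λ = ⋆ L ⋆` -/

section StarToLambda

/-- **`Λ = ⋆ L ⋆`** (Kleiman 1968 1.4.2; Kleiman 1994 §4): for a Lefschetz star operator `⋆` of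
`(X, η)`, `X` smooth projective of dimension `n`, the composite graded operator `⋆ ∘ L ∘ ⋆`
satisfies Kleiman's characterisation `IsLambdaOp` of `Λ`: it vanishes off degree `-2`, kills the
primitive classes (`⋆ x = ± Lⁿ⁻ⁱ x` and `Lⁿ⁻ⁱ⁺¹ x = 0` for `x ∈ Pⁱ`), and
`⋆ L ⋆ (Lʳ⁺¹ x) = ± ⋆ L Lⁿ⁻ⁱ⁻ʳ⁻¹ x = ± ⋆ Lⁿ⁻ⁱ⁻ʳ x = Lʳ x` (the two signs `(-1)^{i(i+1)/2}`
cancel). [cite: Kleiman1968AlgebraicCycles, 1.4.2] -/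
theorem isLambdaOp_star_lefschetz_star (hX : IsSmoothProjective n X) {S : W.GradedOp X X}
    (hS : W.IsLefschetzStar n η S) :
    W.IsLambdaOp n η ((S.comp (W.lefschetzGrPow X η 1)).comp S) := by
  -- the components of `⋆ L ⋆` out of `Hⁱ`, `i + d = 2n`
  have hcomp : ∀ {i d : ℕ} (_ : i + d = 2 * n) (j : ℕ),
      (S.comp (W.lefschetzGrPow X η 1)).comp S i j =
        (S (d + 2) j ∘ₗ W.lefschetzPow X η 1 d (d + 2) rfl) ∘ₗ S i d := by
    intro i d hd j
    rw [W.comp_apply_of_isLefschetzStar hS _ hd, W.comp_lefschetzGrPow_apply]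
  refine ⟨fun i j hij ↦ ?_, fun i x hx j ↦ ?_, fun i x hx r j₁ j₂ h₁ h₂ hr ↦ ?_⟩
  · by_cases hi : i ≤ 2 * n
    · obtain ⟨d, hd⟩ : ∃ d, i + d = 2 * n := ⟨2 * n - i, by omega⟩
      rw [hcomp hd, hS.1 (d + 2) j (by omega), LinearMap.zero_comp, LinearMap.zero_comp]
    · exact W.comp_apply_of_isLefschetzStar_of_lt hS _ (by omega) j
  · by_cases hi : n < i
    · rw [hx.1 hi, map_zero]
    obtain ⟨s, hs⟩ : ∃ s, i + 0 + s = n := ⟨n - i, by omega⟩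
    have hx0 : x = W.lefschetzPow X η 0 i i (by omega) x := by
      rw [W.lefschetzPow_zero hX]
      rfl
    rw [hcomp (by omega : i + (i + 2 * s) = 2 * n), LinearMap.comp_apply, LinearMap.comp_apply,
      hx0, hS.2 i x hx 0 s i (i + 2 * s) (by omega) rfl hs, map_zsmul,
      W.lefschetzPow_lefschetzPow hX η rfl rfl rfl (by omega : i + 2 * (s + 1) = i + 2 * s + 2),
      W.lefschetzPow_eq_zero_of_isPrimitive hX η hx _ (by omega : n + 1 ≤ i + (s + 1)),
      smul_zero, map_zero]
  · obtain ⟨s, hs⟩ : ∃ s, i + (r + 1) + s = n := ⟨n - (i + r + 1), by omega⟩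
    rw [hcomp (by omega : j₁ + (i + 2 * s) = 2 * n), LinearMap.comp_apply, LinearMap.comp_apply,
      hS.2 i x hx (r + 1) s j₁ (i + 2 * s) h₁ rfl hs, map_zsmul,
      W.lefschetzPow_lefschetzPow hX η rfl rfl rfl (by omega : i + 2 * (s + 1) = i + 2 * s + 2),
      map_zsmul, hS.2 i x hx (s + 1) r (i + 2 * s + 2) j₂ (by omega) h₂ (by omega),
      negOnePow_smul_negOnePow_smul]

/-- **`⋆` algebraic ⇒ `Λ` algebraic** (Kleiman 1994 Thm 4-1; Kleiman 1968 Prop. 2.3 with 1.4.2):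
under hard Lefschetz, if every Lefschetz star operator of `(X, η)` is algebraic then `B(X, η)`
holds in `Λ`-form: the unique `Λ` (`isLambdaOp_unique`) is `⋆ ∘ L ∘ ⋆`, a composite of algebraic
graded operators (`isAlgebraicGradedOp_comp_holds`, `isAlgebraicGradedOp_lefschetzGrPow`). [cite: Kleiman1994StandardConjectures, Thm 4-1] -/
theorem standardConjectureBΛ_of_isAlgebraicGradedOp_lefschetzStar (hL : W.HasHardLefschetz)
    (hX : IsSmoothProjective n X) (hη : W.IsHyperplaneClass X η)
    (h : ∀ S : W.GradedOp X X, W.IsLefschetzStar n η S → W.IsAlgebraicGradedOp n n S) :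
    W.StandardConjectureBΛ n X η := by
  intro Λ hΛ
  obtain ⟨S, hS, -⟩ := W.existsUnique_isLefschetzStar_holds (n := n) (X := X) (η := η) hL hX hη
  rw [W.isLambdaOp_unique hL hX hη hΛ (W.isLambdaOp_star_lefschetz_star hX hS)]
  exact W.isAlgebraicGradedOp_comp_holds hX hX hX
    (W.isAlgebraicGradedOp_comp_holds hX hX hX (h S hS)
      (W.isAlgebraicGradedOp_lefschetzGrPow hX (W.mem_ratAlgebraicClasses_of_isHyperplaneClass_aux hX hη) 1))
    (h S hS)

/-- **`⋆` algebraic ⇒ `B(X)`** in `θ`-form (Kleiman 1994 Thm 4-1): combine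
`standardConjectureBΛ_of_isAlgebraicGradedOp_lefschetzStar` with `Λ algebraic ⇒ B(X)`
(`standardConjectureB_of_standardConjectureBΛ`, Kleiman 1968 Prop. 2.3). [cite: Kleiman1994StandardConjectures, Thm 4-1] -/
theorem standardConjectureB_of_isAlgebraicGradedOp_lefschetzStar (hL : W.HasHardLefschetz)
    (hX : IsSmoothProjective n X) (hη : W.IsHyperplaneClass X η)
    (h : ∀ S : W.GradedOp X X, W.IsLefschetzStar n η S → W.IsAlgebraicGradedOp n n S) :
    W.StandardConjectureB n X η :=
  W.standardConjectureB_of_standardConjectureBΛ hL hX hη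
    (W.standardConjectureBΛ_of_isAlgebraicGradedOp_lefschetzStar hL hX hη h)

end StarToLambda

end WeilCohomology

/-! ## Discharge -/

section Discharge

variable {k : Type u} [Field k] {K : Type v} [Field K] [CharZero K]
variable {W : WeilCohomology k K} {n : ℕ} {X : SchemeOver k} {η : W.obj X 2}

/-- **`B(X) ⇔ ⋆ algebraic`** (Kleiman 1994 Thm 4-1; Kleiman 1968 Prop. 2.3 with 1.4.2), discharge
of the named fact `standardConjectureB_iff_isAlgebraicGradedOp_lefschetzStar` (hodge.S29): under
hard Lefschetz, for `X` smooth projective of dimension `n` with hyperplane class `η`, the `θ`-form of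
`B(X, η)` holds iff Kleiman's involution `⋆` of `(X, η)` is induced by algebraic correspondences with
`ℚ`-coefficients (as a graded operator). Both directions are formal in the axioms of
`WeilCohomology` plus hard Lefschetz:
`WeilCohomology.isAlgebraicGradedOp_of_isLefschetzStar_of_standardConjectureB` and
`WeilCohomology.standardConjectureB_of_isAlgebraicGradedOp_lefschetzStar`. [cite: Kleiman1994StandardConjectures, Thm 4-1] [cite: Kleiman1968AlgebraicCycles, Prop. 2.3 and 1.4.2] -/
theorem standardConjectureB_iff_isAlgebraicGradedOp_lefschetzStar_holds :
    standardConjectureB_iff_isAlgebraicGradedOp_lefschetzStar (W := W) (n := n) (X := X) (η := η) :=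
  fun hL hX hη ↦
    ⟨fun hB _ hS ↦ W.isAlgebraicGradedOp_of_isLefschetzStar_of_standardConjectureB hL hX hη hB hS,
      W.standardConjectureB_of_isAlgebraicGradedOp_lefschetzStar hL hX hη⟩

end Discharge

end Literature.AlgebraicGeometry.Motives

end
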